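import Summits.NavierStokesRegularity.NavierStokesRegularity.Theses.QuantisedSymmetry
import Summits.NavierStokesRegularity.NavierStokesRegularity.Theses.Blowup
import Summits.NavierStokesRegularity.NavierStokesRegularity.Theses.FilamentSkeletonRss
import Summits.NavierStokesRegularity.NavierStokesRegularity.Theorems.QuantisedSymmetryPolyhedralTruncationBridge
import Summits.NavierStokesRegularity.NavierStokesRegularity.Theorems.QuantisedSymmetryPolyhedralDssProfileExistsDominatesBlowupProfile
import Summits.NavierStokesRegularity.NavierStokesRegularity.Theorems.QuantisedSymmetryPolyhedralDssProfileExistsLerayOrbitOfProfile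
import Summits.NavierStokesRegularity.NavierStokesRegularity.Theorems.FilamentSkeletonRssRdssProfileTruncation
import Literature.Analysis.FluidPDE.SelfSimilarLiouville
import Literature.Analysis.FluidPDE.AncientSimilarityVariables
import HarnessLib

/-!
# Strategist sketch S19 (family `s`, independent census) — crux `PolyhedralDssProfileExists` (stmt-1404)

Typed record for `STRATEGY-CENSUS-s19.md`:
* §0 what the tree already certifies: X⁻ alone decides the summit negatively; X⁻ dominates the
  sector-agnostic profile crux W1 = `Blowup.BlowupTypeIDssProfile` (stmt-0155/14193), and W1, W3 =
  `Blowup.BlowupExists` (X5a) are themselves summit-deciding by landed theorems;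
* §1 candidate weaker intermediates W1–W3 (all ≥ ¬S);
* §2 the best typed decomposition (approximation + compactness over the periodic-Leray-orbit form,
  landed `polyhedralDssProfileExists_iff_periodicLerayOrbit`), with its assembly PROVED and the
  proof that the approximant piece is implied by the crux (so it is crux-equivalent modulo the
  routine compactness piece);
* §3 the Newton–Kantorovich strengthening S⁺ and the proof S⁺ → X⁻ (Banach fixed point).
No `sorry`.
-/

set_option linter.dupNamespace false
set_option linter.unusedVariables false

namespace Summit.NavierStokesRegularity.NavierStokesRegularity.Cruxes.PolyhedralDssProfileExists.S19

open Set Function MeasureTheory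
open Literature.Analysis.FluidPDE
open _root_.Summit.NavierStokesRegularity.NavierStokesRegularity.Theses
open _root_.Summit.NavierStokesRegularity.NavierStokesRegularity.Theorems
open _root_.Summit.NavierStokesRegularity.NavierStokesRegularity.Theorems.PolyhedralDssProfileExists.PolyhedralCell

local notation "E3" => EuclideanSpace ℝ (Fin 3)

/-! ## §0 Certified chain -/

/-- X⁻ ALONE decides the summit negatively: all other binders of `QuantisedSymmetry.closes` are proved
(`quantisedSymmetry_polyhedralTruncationBridge_proof`, `ClayUniqueness_holds`). -/
theorem crux_decides_negatively :
    QuantisedSymmetry.PolyhedralDssProfileExists → ¬ _root_.NavierStokesRegularity := fun hX =>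
  QuantisedSymmetry.closes hX quantisedSymmetry_polyhedralTruncationBridge_proof
    QuantisedSymmetry.ClayUniqueness_holds

/-- X⁻ dominates the sector-agnostic profile crux W1 (landed `stub_dominatesBlowupProfile`). -/
theorem crux_dominates_w1 :
    QuantisedSymmetry.PolyhedralDssProfileExists → Blowup.BlowupTypeIDssProfile :=
  stub_dominatesBlowupProfile

/-- W1 ⇒ X5a by the landed sector-agnostic truncation `filamentSkeletonRss_rdssProfileTruncation_proof`. -/
theorem blowupExists_of_w1 (h : Blowup.BlowupTypeIDssProfile) : Blowup.BlowupExists := by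
  by_contra hne
  apply h
  intro c
  have key : ∀ R : E3 ≃ₗᵢ[ℝ] E3, RotatedTypeIDSSLiouville c R := by
    intro R hc u hmild hmeas hrdss hdec
    by_contra hnt
    exact hne (filamentSkeletonRss_rdssProfileTruncation_proof ⟨c, R, u, hc, hmild, hmeas, hrdss, hdec, hnt⟩)
  exact ⟨(rotatedTypeIDSSLiouville_refl_iff c).1 (key _), key⟩

/-- W3 = X5a decides the summit (landed `Blowup.closes` + `BlowupClayUniqueness_holds`). -/
theorem w3_decides : Blowup.BlowupExists → ¬ _root_.NavierStokesRegularity := fun h =>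
  Blowup.closes h Blowup.BlowupClayUniqueness_holds

/-- W1 decides the summit. -/
theorem w1_decides : Blowup.BlowupTypeIDssProfile → ¬ _root_.NavierStokesRegularity := fun h =>
  w3_decides (blowupExists_of_w1 h)

/-! ## §1 A further candidate intermediate: Type-I-RATE finite-energy blow-up (W2) -/

/-- W2: a finite-energy Leray–Hopf classical solution from a rapidly decaying datum with finite maximal
time `T` AND the Type-I rate `‖u(t)‖_∞ ≤ C/√(T−t)`. (X⁻ ⇒ W2 is NOT landed — the truncation's blow-up
rate is not recorded; W2 ⇒ ¬S by dropping the rate.) -/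
def TypeIRateBlowupExists : Prop :=
  ∃ ν : ℝ, 0 < ν ∧ ∃ T : ℝ, 0 < T ∧ ∃ (u : ℝ → E3 → E3) (p : ℝ → E3 → ℝ),
    IsMaximalSmoothSolution ν 0 u p T ∧ IsLerayHopfOn T ν 0 (u 0) u ∧ HasRapidSpatialDecay (u 0) ∧
    ∃ C : ℝ, ∀ t ∈ Ico 0 T, ∀ x, ‖u t x‖ ≤ C / Real.sqrt (T - t)

theorem w2_decides : TypeIRateBlowupExists → ¬ _root_.NavierStokesRegularity := by
  rintro ⟨ν, hν, T, hT, u, p, hmax, hLH, hdec, -⟩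
  exact w3_decides ⟨ν, hν, T, hT, u, p, hmax, hLH, hdec⟩

/-! ## §2 Decomposition: approximation + compactness over the periodic-Leray-orbit form -/

/-- finite irreducible proper rotation group (the crux's group clauses). -/
def IsPolyhedralGroup (G : Subgroup (E3 ≃ₗᵢ[ℝ] E3)) : Prop :=
  Finite G ∧ (∀ g ∈ G, LinearMap.det (g.toLinearEquiv : E3 →ₗ[ℝ] E3) = 1) ∧
    (∀ V : Submodule ℝ E3, (∀ g ∈ G, ∀ v ∈ V, g v ∈ V) → V = ⊥ ∨ V = ⊤)

/-- An `ε`-approximate polyhedral Leray orbit: an `S`-periodic `G`-equivariant classical solution of the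
backward Leray system up to a smooth forcing defect `F` of weighted size `≤ ε`, with Type-I weight
`(1+‖y‖)‖U‖ ≤ C₀` and normalised from below by `δ` (the Type-I weight confines the normalising point to
`‖y‖ ≤ C₀/δ − 1`, so no ball constraint is needed). -/
def IsApproxOrbit (G : Subgroup (E3 ≃ₗᵢ[ℝ] E3)) (S C₀ δ ε : ℝ) (U : ℝ → E3 → E3) : Prop :=
  ∃ (P : ℝ → E3 → ℝ) (F : ℝ → E3 → E3),
    IsClassicalNSSolutionOn univ 1 (fun s y => rescaledEulerLerayForce 1 U s y + F s y) U P ∧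
    Function.Periodic U S ∧ (∀ s y, (1 + ‖y‖) * ‖U s y‖ ≤ C₀) ∧
    (∀ g ∈ G, ∀ s y, U s (g y) = g (U s y)) ∧
    (∀ s y, (1 + ‖y‖) ^ 3 * ‖F s y‖ ≤ ε) ∧ (∃ s y, δ ≤ ‖U s y‖)

/-- Piece D₂ (the "construction" half): approximate orbits with UNIFORM period, Type-I constant and
normalisation exist for every defect size `ε > 0`. -/
def ApproximateOrbitsExist : Prop :=
  ∃ G : Subgroup (E3 ≃ₗᵢ[ℝ] E3), IsPolyhedralGroup G ∧ ∃ S : ℝ, 0 < S ∧ ∃ C₀ δ : ℝ, 0 < δ ∧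
    ∀ ε > 0, ∃ U, IsApproxOrbit G S C₀ δ ε U

/-- Piece D₁ (the "compactness" half, routine parabolic regularity + Arzelà–Ascoli + passage to the
limit in the weak form; nontriviality of the limit from the confined normalising points): a family of
approximate orbits with uniform data has an exact nontrivial orbit as a limit. -/
def OrbitCompactness : Prop :=
  ∀ G : Subgroup (E3 ≃ₗᵢ[ℝ] E3), IsPolyhedralGroup G → ∀ S : ℝ, 0 < S → ∀ C₀ δ : ℝ, 0 < δ →
    (∀ ε > 0, ∃ U, IsApproxOrbit G S C₀ δ ε U) →
      ∃ (U : ℝ → E3 → E3) (P : ℝ → E3 → ℝ), IsBackwardLeraySolutionOn univ 1 U P ∧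
        Function.Periodic U S ∧ (∃ C₀' : ℝ, ∀ s y, (1 + ‖y‖) * ‖U s y‖ ≤ C₀') ∧
        (∀ g ∈ G, ∀ s y, U s (g y) = g (U s y)) ∧ (∃ s y, U s y ≠ 0)

/-- ASSEMBLY of the split, PROVED: D₁ → D₂ → X⁻ (via the landed
`polyhedralDssProfileExists_of_periodicLerayOrbit`). -/
theorem crux_of_split : OrbitCompactness → ApproximateOrbitsExist →
    QuantisedSymmetry.PolyhedralDssProfileExists := by
  rintro hD1 ⟨G, ⟨hfin, hdet, hirr⟩, S, hS, C₀, δ, hδ, happ⟩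
  obtain ⟨U, P, hsol, hper, hbd, heqv, hne⟩ := hD1 G ⟨hfin, hdet, hirr⟩ S hS C₀ δ hδ happ
  exact polyhedralDssProfileExists_of_periodicLerayOrbit ⟨G, hfin, hdet, hirr, S, hS, U, P, hsol, hper,
    hbd, heqv, hne⟩

/-- HONESTY CHECK of the split: the construction piece D₂ is IMPLIED BY the crux (take the exact orbit of
the landed `stub_lerayOrbitOfProfile`, defect `F = 0`). Hence, modulo the routine piece D₁, D₂ ↔ X⁻:
the split isolates nothing strictly weaker than the crux. -/
theorem approx_of_crux : QuantisedSymmetry.PolyhedralDssProfileExists → ApproximateOrbitsExist := by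
  intro hX
  obtain ⟨G, hfin, hdet, hirr, S, hS, U, P, hsol, hper, ⟨C₀, hbd⟩, heqv, ⟨s₀, y₀, hne⟩⟩ :=
    stub_lerayOrbitOfProfile hX
  refine ⟨G, ⟨hfin, hdet, hirr⟩, S, hS, C₀, ‖U s₀ y₀‖, norm_pos_iff.2 hne, fun ε hε => ⟨U, P, 0, ?_, hper,
    hbd, heqv, ?_, ⟨s₀, y₀, le_rfl⟩⟩⟩
  · have e : (fun s y => rescaledEulerLerayForce 1 U s y + (0 : ℝ → E3 → E3) s y) =
        rescaledEulerLerayForce 1 U := by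
      funext s y; simp
    rw [e]; exact hsol
  · intro s y; simp [hε.le]

/-! ## §3 Strengthen: a Newton–Kantorovich / contraction certificate S⁺ and S⁺ → X⁻ -/

/-- S⁺ (certificate shape): a complete metric space `Y` (G-equivariant `S`-periodic weighted fields in
the EVENMAP fixed-point form `U = 𝔅(U,U)`), a closed nonempty set `s` (a ball about a numerical
candidate, excluding `0`), a self-map `Φ` of `s` (Newton-preconditioned) contracting on `s`, and the
soundness clause "a fixed point in `s` is a witness of X⁻". -/
def NKCertifiedCell : Prop :=
  ∃ (Y : Type) (_ : MetricSpace Y) (_ : CompleteSpace Y) (Φ : Y → Y) (s : Set Y) (K : NNReal),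
    IsClosed s ∧ s.Nonempty ∧ MapsTo Φ s s ∧ LipschitzOnWith K Φ s ∧ K < 1 ∧
    (∀ U ∈ s, IsFixedPt Φ U → QuantisedSymmetry.PolyhedralDssProfileExists)

/-- S⁺ → X⁻ (Banach fixed point on a complete subset, `ContractingWith.exists_fixedPoint'`). -/
theorem crux_of_certificate : NKCertifiedCell → QuantisedSymmetry.PolyhedralDssProfileExists := by
  rintro ⟨Y, _, _, Φ, s, K, hcl, ⟨x, hx⟩, hmaps, hlip, hK, hsound⟩
  have hc : ContractingWith K (hmaps.restrict Φ s s) := ⟨hK, hlip.mapsToRestrict hmaps⟩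
  obtain ⟨y, hy, hfix, -⟩ :=
    ContractingWith.exists_fixedPoint' hcl.isComplete hmaps hc hx (edist_ne_top _ _)
  exact hsound y hy hfix

end Summit.NavierStokesRegularity.NavierStokesRegularity.Cruxes.PolyhedralDssProfileExists.S19
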